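import Literature.MathematicalPhysics.QuantumFieldTheory.Balaban1983to89.B1Eq324BenfattoSect5PerBoxOnData
import Literature.MathematicalPhysics.QuantumFieldTheory.Balaban1983to89.B1Eq324BenfattoSect5TupleClusters
import HarnessLib

/-!
# `Balaban1983to89.B1Eq324BenfattoSect5PerBoxAppD` — [BenfattoEtAl1978] §5 pp. 157–159: the per-box relation (5.30)→(5.33)/(5.36) on
# print's objects WITH THE TWO APPENDIX-D INPUTS SUPPLIED — (5.29)₂ across `Γ₄(□)` and the (5.31) «(error)» at depth `w − v` — from
# `…Sect5TupleClusters` and the corridor geometry of `…Sect5LegGeometry`; only the coefficient masses stay displayed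

statement-level skeleton of published theorems with citation tags; proofs where landed; nothing here is a claim about the
Yang–Mills mass gap

WHY THIS MODULE (cell `pub-ymgap`, seat `dag-n08-b`, node N08; sequel of `B1Eq324BenfattoSect5PerBoxOnData`, whose
`perBox_condField` displays, per colouring `f` of `k ≤ t` slots by the pieces `Ψ′₁, Ψ″₁, Ψ₂`, the two Appendix-D inputs on the UNCUT
conditioned slots: `|𝓔^T_{P̄}(f)| ≤ δ₂₉(k)` for `f` using `Ψ″₁` and `Ψ₂`, and `|𝓔^T_{P̄}(f) − 𝓔^T_{P̂₀}(f)| ≤ δ₃₁(k)` for `f` using `Ψ″₁`,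
avoiding `Ψ₂`).  The sibling seat's `B1Eq324BenfattoSect5TupleClusters` proves both for tuple-class slots, uniformly in the colouring:
`abs_ursellOf_tupleSums_condField_le_exp_of_separated` (Appendix D's connected diagrams with two classes meeting regions `R_A`, `R_B` at
`ℓ¹`-distance `≥ ρ₀`) and `abs_ursellOf_tupleSums_condField_sub_P0_le` ((5.31): leg-wise `ε`-closeness of the conditioned mean /
covariance to the free ones).  This file plugs them in with print's geometry: `R_A = □′∖Γ₄(□)` (every `Ψ″₁`-tuple meets it — «each
monomials contains at least one z_Δ with Δ ⊂ □′∖Γ₄(□)», `…Eq524.exists_mem_core_sdiff_frame4`), `R_B = Γ₁(□)∪Γ₂(□)` (where `Ψ₂` lives),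
`ρ₀ = v + 1` across `Γ₄(□)` (`…LegGeometry.le_l1_core_sdiff_frame4_of_not_mem_core`); and for (5.31) the tesserae of `Ψ′₁, Ψ″₁` lie in
`□′∪Γ₃(□)`, at depth `w − v` below `Γ ⊇ Γ₁(□)` (conditioning set disjoint from `□′∪Γ₂(□)`), where `…LegGeometry.abs_condMean_le_of_mem_shrink`
/ `abs_freeCov_sub_condCov_le_of_mem_shrink` give the `θ^{w−v}`-small `ε` (`θ = 2d/(2d+α²)`); the a-priori level `K₀ = max(1, C₀₀,
(1+2d/α²)γb)` is (C.8) on `I` (`…SlotMoments.abs_condMean_le_of_mem`) and (C.5)–(C.6) (`…AppendixC2`).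

DICTIONARY.  As in `…Sect5PerBoxOnData`; in addition `δ₂₉(k) = 2^{kD}2^{2^{kD}}K₀^{kD}e^{−(δ/2)(v+1)}M̃^k`,
`δ₃₁(k) = M^k·2^{kD}2^{2^{kD}}·kD·K₀^{kD}·ε₃₁`, `ε₃₁ = max(β·2dC₀₀θ^{w−v}·γbΣ_{c∈Γ₁(□)}(1+d(Δ_c,I)), 2dC₀₀θ^{w−v}/α²)`, `M` / `M̃` the
decay-weighted / `δ`-inflated coefficient masses of the three classes (displayed), `0 ≤ δ ≤ log((2d+α²)/2d)` any propagator rate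
(print's `ϰ̃`: take `δ < ϰ/(D²√d)` so that `M̃` is a lattice sum at rate `ϰ/4`).

WHAT IS PROVED (theorems only; no definition, no named fact, no `sorry`; axioms standard).
* ★★ **`perBox_condField_appD`** — `…PerBoxOnData.perBox_condField` with `δ₂₉`, `δ₃₁` SUPPLIED: the same five-fold conclusion
  (`0 < lhs`, `0 < rhs`, `|log lhs − log rhs − E| ≤ Err`, `e^{E−Err}·rhs ≤ lhs ≤ e^{E+Err}·rhs`) with `Err` now explicit in
  `(s, D, d, ϰ, α, β, γ, b, L, w, v, t, A, M, M̃, δ)`; private `mem_shrink_of_mem_class01` (the `Ψ′₁/Ψ″₁` tesserae lie in `shrink (w + (w−v))`).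

HONEST SCOPE / NOT HERE.  (i) The masses `M`, `M̃` stay displayed (boxes-line lattice sums: `|A| ≤ A`, `Σ_Δ e^{−(ϰ/4)d(Δ)}` anchored in
`□`, `…Sect5Eq511.sum_exp_quarter_le` / `…Eq524.sum_exp_anchored_le`).  (ii) AS PROVED vs AS PRINTED: print's (5.29) `s₄(s₂b^{D+2d}A)^k
(e^{−b²/4} + e^{−ϰ̃b^{3/2}})` ↦ `cχ(k) + δ₂₉(k)` with `v + 1` in place of `½b^{3/2}` (print's `v`) and the `θ^{w−v}` depth rate for (5.31);
the exponent budget of `errTerm` (one `ρ₃`) is an assembly-time choice of the widths `w, v` (sibling seat's design note), not made here.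
(iii) NOT here: the product over boxes, (5.34)/(5.35), pavements, `errTerm`, `b*`.  `BasicLemmaPrinted` stays OPEN.  NOT summit progress;
count-neutral for N08; nothing of [Balaban1985UV3] (41)/(47)/(5) is asserted.
-/

open MeasureTheory ProbabilityTheory Finset
open scoped BigOperators Nat

namespace Literature.MathematicalPhysics.QuantumFieldTheory.Balaban1983to89.B1Eq324BenfattoSect5PerBoxAppD

open _root_.MeasureTheory _root_.ProbabilityTheory
open Literature.Probability.LatticeModels (setPartitions ursellOf)
open Literature.MathematicalPhysics.QuantumFieldTheory
open Literature.MathematicalPhysics.QuantumFieldTheory.Balaban1983to89.B1Eq324BenfattoLemma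
open Literature.MathematicalPhysics.QuantumFieldTheory.Balaban1983to89.B1Eq324BenfattoSect5Boxes
open Literature.MathematicalPhysics.QuantumFieldTheory.Balaban1983to89.B1Eq324BenfattoSect5Eq511
open Literature.MathematicalPhysics.QuantumFieldTheory.Balaban1983to89.B1Eq324BenfattoSect5Eq524
open Literature.MathematicalPhysics.QuantumFieldTheory.Balaban1983to89.B1Eq324BenfattoSect5Eq534
open Literature.MathematicalPhysics.QuantumFieldTheory.Balaban1983to89.B1Eq324BenfattoSect5Eq515
open Literature.MathematicalPhysics.QuantumFieldTheory.Balaban1983to89.B1Eq324GaussianMomentLeaf (momentConst one_le_momentConst)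
open Literature.MathematicalPhysics.QuantumFieldTheory.Balaban1983to89.B1Eq324BenfattoSect5LegGeometry
  (le_l1_core_sdiff_frame4_of_not_mem_core not_mem_core_of_mem_frame1_union_frame2 abs_condMean_le_of_mem_shrink
   abs_freeCov_sub_condCov_le_of_mem_shrink)
open Literature.MathematicalPhysics.QuantumFieldTheory.Balaban1983to89.B1Eq324BenfattoAppendixC2
  (freeCov_nonneg freeCov_le_diag condCov_freeCov_nonneg_le)
open Literature.MathematicalPhysics.QuantumFieldTheory.Balaban1983to89.B1Eq324BenfattoSect5PerBoxOnData (perBox_condField)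

variable {d : ℕ}

/-! ## §1  THE PLUG: the two Appendix-D inputs supplied by `…Sect5TupleClusters` + the corridor geometry of `…Sect5LegGeometry` -/

section Plug

variable {α β : ℝ} {s D : ℕ} {κ : ℝ} {a : Coef d} {J I : Finset (B1Eq324BenfattoLemma.Site d)} {L w v : ℕ}
  {m : B1Eq324BenfattoLemma.Site d} {Γ : Finset (B1Eq324BenfattoLemma.Site d)} {ξ : B1Eq324BenfattoLemma.Site d → ℝ}
  {γ b A M : ℝ}

/-- The tesserae of the `Ψ′₁`/`Ψ″₁` classes lie in `□′ ∪ Γ₃(□) = shrink (w + (w − v))` (`v ≤ w`). [cite: BenfattoEtAl1978, (5.23)/(5.27) p.157] -/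
private theorem mem_shrink_of_mem_class01 (hv : v ≤ w) (T : Fin 3 → (p : ℕ) → Finset (Fin p → J))
    (hT0 : ∀ p, T 0 p = tuplesIn J p (frame4 L w v m) ∪ crossT J p (frame4 L w v m) (frame3 L w v m))
    (hT1 : ∀ p, T 1 p = (tuplesIn J p (core L w m) \ tuplesIn J p (frame4 L w v m)) ∪
      (crossT J p (core L w m) (frame3 L w v m) \ crossT J p (frame4 L w v m) (frame3 L w v m)))
    {c : Fin 3} (hc : c = 0 ∨ c = 1) {p : ℕ} {Δ : Fin p → J} (hΔ : Δ ∈ T c p) (i : Fin p) :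
    (Δ i : B1Eq324BenfattoLemma.Site d) ∈ shrink L m (w + (w - v)) := by
  have hcf : core L w m ∪ frame3 L w v m = shrink L m (w + (w - v)) := by
    rw [core_union_frame3, show 2 * w - v = w + (w - v) by omega]
  rw [← hcf]
  have h43 : frame4 L w v m ∪ frame3 L w v m ⊆ core L w m ∪ frame3 L w v m :=
    Finset.union_subset_union (frame4_subset_core L w v m) le_rfl
  rcases hc with rfl | rfl
  · rw [hT0, Finset.mem_union] at hΔ
    rcases hΔ with h | h
    · exact h43 (Finset.mem_union_left _ ((mem_tuplesIn.1 h) i))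
    · exact h43 ((mem_crossT.1 h).1 i)
  · rw [hT1, Finset.mem_union] at hΔ
    rcases hΔ with h | h
    · exact Finset.mem_union_left _ ((mem_tuplesIn.1 (Finset.mem_sdiff.1 h).1) i)
    · exact (mem_crossT.1 (Finset.mem_sdiff.1 h).1).1 i

/-- **THE PER-BOX RELATION ON PRINT'S OBJECTS WITH THE APPENDIX-D INPUTS SUPPLIED** — `perBox_condField` with
`δ₂₉(k) = 2^{kD}2^{2^{kD}}K₀^{kD}·e^{−(δ/2)(v+1)}·M̃^k` ((5.29)₂: `…TupleClusters.abs_ursellOf_tupleSums_condField_le_exp_of_separated` with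
`R_A = □′∖Γ₄(□) = shrink (2w+v)` — every `Ψ″₁`-tuple meets it, `…Eq524.exists_mem_core_sdiff_frame4` — and `R_B = Γ₁(□)∪Γ₂(□)` — every
`Ψ₂`-tuple lies there —, `ℓ¹ ≥ v + 1` across `Γ₄(□)` by `…LegGeometry.le_l1_core_sdiff_frame4_of_not_mem_core`) and
`δ₃₁(k) = M^k·2^{kD}2^{2^{kD}}·kD·K₀^{kD}·ε` ((5.31) «(error)»: `…TupleClusters.abs_ursellOf_tupleSums_condField_sub_P0_le` — the
`Ψ′₁`/`Ψ″₁` tesserae lie in `□′∪Γ₃(□) = shrink (w + (w−v))`, at depth `w − v` from `Γ ⊇ Γ₁(□)` (disjoint from `□′∪Γ₂(□)`), where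
`…LegGeometry.abs_condMean_le_of_mem_shrink` / `abs_freeCov_sub_condCov_le_of_mem_shrink` give
`ε = max(β·2dC₀₀θ^{w−v}·γbΣ_{c∈Γ₁(□)}(1+d(Δ_c,I)), 2dC₀₀θ^{w−v}/α²)`, `θ = 2d/(2d+α²)`), `K₀ = max(1, C₀₀, (1+2d/α²)γb)`
((C.8) on `I`, `…SlotMoments.abs_condMean_le_of_mem`; (C.5)–(C.6) `…AppendixC2`), any propagator rate `0 ≤ δ ≤ log((2d+α²)/2d)`;
the decay-weighted masses `M` and the `δ`-inflated masses `M̃` of the three classes stay displayed (lattice-sum bookkeeping of the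
boxes line).  Same five-fold conclusion as `perBox_condField`. [cite: BenfattoEtAl1978, (5.29)–(5.33) pp.157–159, (5.36) p.159] -/
theorem perBox_condField_appD (hα : 0 < α) (hβ : 0 < β) (hvar : freeCov d α β 0 0 ≤ 1 / 2) (hd : 0 < d)
    (hκ : 0 < κ) (hJ : CoefSupportedIn a J) (hJI : J ⊆ I) (hA0 : 0 ≤ A)
    (hA : ∀ (p : ℕ) (Δ : Fin p → B1Eq324BenfattoLemma.Site d) (n : Fin p → ℕ), |a p Δ n| ≤ A)
    (hv : v ≤ w) (hw : 1 ≤ w) (hb : 1 ≤ b) (hγ0 : 0 ≤ γ) (hγ1 : γ ≤ 1) (hγ : γ * (1 + 2 * d / α ^ 2) ≤ 1 / 2)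
    (hΓ : frame1 L w m ⊆ Γ) (hΓd : Disjoint Γ (shrink L m w)) (hξ : ∀ c ∈ Γ, |ξ c| ≤ γ * b * (1 + distToRegion I c))
    (hsmall : ((shrink L m w).card : ℝ) * Real.exp (-(b ^ 2 / 4)) ≤ 1 / 6)
    (T : Fin 3 → (p : ℕ) → Finset (Fin p → J))
    (hT0 : ∀ p, T 0 p = tuplesIn J p (frame4 L w v m) ∪ crossT J p (frame4 L w v m) (frame3 L w v m))
    (hT1 : ∀ p, T 1 p = (tuplesIn J p (core L w m) \ tuplesIn J p (frame4 L w v m)) ∪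
      (crossT J p (core L w m) (frame3 L w v m) \ crossT J p (frame4 L w v m) (frame3 L w v m)))
    (hT2 : ∀ p, T 2 p = crossT J p (frame1 L w m) (frame2 L w m) ∪ tuplesIn J p (frame2 L w m))
    (hM : ∀ c, ∑ p ∈ Finset.Icc 1 s, ∑ Δ ∈ T c p, ∑ n ∈ admissible p D,
      |a p (fun i => (Δ i : B1Eq324BenfattoLemma.Site d)) n| *
        Real.exp (-(κ / 2) * connLength fun i => (Δ i : B1Eq324BenfattoLemma.Site d)) ≤ M)
    {δ : ℝ} (hδ0 : 0 ≤ δ) (hδle : δ ≤ Real.log ((2 * d + α ^ 2) / (2 * d))) {Mt : ℝ}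
    (hMt : ∀ c, ∑ p ∈ Finset.Icc 1 s, ∑ Δ ∈ T c p, ∑ n ∈ admissible p D,
      |a p (fun i => (Δ i : B1Eq324BenfattoLemma.Site d)) n| *
        Real.exp (-(κ / 2) * connLength fun i => (Δ i : B1Eq324BenfattoLemma.Site d)) *
        Real.exp (δ / 2 * ((D : ℝ) ^ 2 * (Real.sqrt d * connLength (fun i => (Δ i : B1Eq324BenfattoLemma.Site d)) + d))) ≤ Mt)
    (t : ℕ) :
    let K : ℝ := 4 * (s1Const s D d κ * A * b ^ D * (L : ℝ) ^ d)
    let ε : ℝ := s1Const s D d κ * A * b ^ D * Real.exp (-(κ / 4 * v)) * (L : ℝ) ^ d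
    let W : ℝ := 3 * (((shrink L m w).card : ℝ) * Real.exp (-(b ^ 2 / 4)))
    let cχ : ℕ → ℝ := fun k => 2 ^ k * ((∑ π ∈ setPartitions (univ : Finset (Fin k)), ((π.card - 1)! : ℝ)) *
        ((min 1 (2 * ((shrink L m w).card : ℝ) * Real.exp (-(b ^ 2 / 4)))) ^ ((2 * k : ℕ) : ℝ)⁻¹ *
          ((1 + (1 + 2 * d / α ^ 2) * (γ * b)) ^ D * M * momentConst D (2 * k) (freeCov d α β 0 0).toNNReal) ^ k))
    let K₀ : ℝ := max (max 1 (freeCov d α β 0 0)) ((1 + 2 * d / α ^ 2) * (γ * b))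
    let ε₃₁ : ℝ := max (β * (2 * d * (freeCov d α β 0 0 * (2 * d / (2 * d + α ^ 2)) ^ (w - v))) *
          (γ * b * ∑ c ∈ frame1 L w m, (1 + distToRegion I c)))
        (2 * d * freeCov d α β 0 0 * (2 * d / (2 * d + α ^ 2)) ^ (w - v) / α ^ 2)
    let δ₂₉ : ℕ → ℝ := fun k => 2 ^ (k * D) * 2 ^ 2 ^ (k * D) * K₀ ^ (k * D) * Real.exp (-(δ / 2 * ((v : ℝ) + 1))) * Mt ^ k
    let δ₃₁ : ℕ → ℝ := fun k => M ^ k * (2 ^ (k * D) * 2 ^ 2 ^ (k * D) * ((k * D : ℕ) * K₀ ^ (k * D) * ε₃₁))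
    let lhs : ℝ := ∫ z in smallFieldOn (shrink L m w : Set (B1Eq324BenfattoLemma.Site d)) I b,
          Real.exp (psiBox s D κ a L w m z) ∂condField d α β Γ ξ
    let rhs : ℝ := ∫ z in smallFieldOn (shrink L m w : Set (B1Eq324BenfattoLemma.Site d)) I b,
          Real.exp (psi1p s D κ a L w v m z + psi2 s D κ a L w m z) ∂condField d α β Γ ξ
    let E : ℝ := ∑ k ∈ Finset.range t,
            (∑ f ∈ univ.filter (fun f : Fin (k + 1) → Fin 3 => (∃ j, f j = 1) ∧ ∀ j, f j ≠ 2),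
              ursellOf (fun P : Finset (Fin (k + 1)) => ∫ z, ∏ j ∈ P,
                (∑ p ∈ Finset.Icc 1 s, ∑ Δ ∈ T (f j) p, ∑ n ∈ admissible p D, term κ a z p Δ n) ∂P0 d α β) univ)
              / (k + 1)!
    let Err : ℝ := 2 * (2 ^ ((t + 1).choose 2) * K ^ (t + 1) / (t + 1)!) + Real.exp (2 * K) * W
        + ∑ k ∈ Finset.range t,
            (3 ^ (k + 1) * ((∑ π ∈ setPartitions (univ : Finset (Fin (k + 1))), ((π.card - 1)! : ℝ)) * (ε * K ^ k))
              + 3 ^ (k + 1) * (cχ (k + 1) + δ₂₉ (k + 1)) + 3 ^ (k + 1) * (cχ (k + 1) + δ₃₁ (k + 1))) / (k + 1)!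
    0 < lhs ∧ 0 < rhs ∧ |Real.log lhs - Real.log rhs - E| ≤ Err ∧
      Real.exp (E - Err) * rhs ≤ lhs ∧ lhs ≤ Real.exp (E + Err) * rhs := by
  intro K ε W cχ K₀ ε₃₁ δ₂₉ δ₃₁
  -- constants
  have hC00 : 0 ≤ freeCov d α β 0 0 := freeCov_nonneg hα hβ 0 0
  have hθ0 : (0 : ℝ) ≤ 2 * d / (2 * d + α ^ 2) := by positivity
  have hγb : 0 ≤ γ * b := mul_nonneg hγ0 (zero_le_one.trans hb)
  have hK₀1 : 1 ≤ K₀ := (le_max_left _ _).trans (le_max_left _ _)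
  have hK₀C : freeCov d α β 0 0 ≤ K₀ := (le_max_right _ _).trans (le_max_left _ _)
  have hK₀u : (1 + 2 * d / α ^ 2) * (γ * b) ≤ K₀ := le_max_right _ _
  have hK₀0 : 0 ≤ K₀ := zero_le_one.trans hK₀1
  have hθpow : (0 : ℝ) ≤ (2 * d / (2 * d + α ^ 2)) ^ (w - v) := pow_nonneg hθ0 _
  have hε₃₁0 : 0 ≤ ε₃₁ :=
    le_max_of_le_right (div_nonneg (mul_nonneg (mul_nonneg (by positivity) hC00) hθpow) (sq_nonneg _))
  have hM0 : 0 ≤ M := (Finset.sum_nonneg fun p _ => Finset.sum_nonneg fun Δ _ => Finset.sum_nonneg fun n _ =>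
    mul_nonneg (abs_nonneg _) (Real.exp_pos _).le).trans (hM 0)
  have hmass0 : ∀ c, 0 ≤ ∑ p ∈ Finset.Icc 1 s, ∑ Δ ∈ T c p, ∑ n ∈ admissible p D,
      |a p (fun i => (Δ i : B1Eq324BenfattoLemma.Site d)) n| *
        Real.exp (-(κ / 2) * connLength fun i => (Δ i : B1Eq324BenfattoLemma.Site d)) := fun c =>
    Finset.sum_nonneg fun p _ => Finset.sum_nonneg fun Δ _ => Finset.sum_nonneg fun n _ =>
      mul_nonneg (abs_nonneg _) (Real.exp_pos _).le
  have hmasst0 : ∀ c, 0 ≤ ∑ p ∈ Finset.Icc 1 s, ∑ Δ ∈ T c p, ∑ n ∈ admissible p D,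
      |a p (fun i => (Δ i : B1Eq324BenfattoLemma.Site d)) n| *
        Real.exp (-(κ / 2) * connLength fun i => (Δ i : B1Eq324BenfattoLemma.Site d)) *
        Real.exp (δ / 2 * ((D : ℝ) ^ 2 * (Real.sqrt d * connLength (fun i => (Δ i : B1Eq324BenfattoLemma.Site d)) + d))) :=
    fun c => Finset.sum_nonneg fun p _ => Finset.sum_nonneg fun Δ _ => Finset.sum_nonneg fun n _ =>
      mul_nonneg (mul_nonneg (abs_nonneg _) (Real.exp_pos _).le) (Real.exp_pos _).le
  have hMt0 : 0 ≤ Mt := (hmasst0 0).trans (hMt 0)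
  have happ : ∀ n : ℕ, (0 : ℝ) ≤ 2 ^ n * 2 ^ 2 ^ n * K₀ ^ n := fun n =>
    mul_nonneg (mul_nonneg (pow_nonneg (by norm_num) _) (pow_nonneg (by norm_num) _)) (pow_nonneg hK₀0 _)
  have hδ₂₉0 : ∀ k, 0 ≤ δ₂₉ k := fun k => by
    show (0 : ℝ) ≤ 2 ^ (k * D) * 2 ^ 2 ^ (k * D) * K₀ ^ (k * D) * Real.exp (-(δ / 2 * ((v : ℝ) + 1))) * Mt ^ k
    exact mul_nonneg (mul_nonneg (happ _) (Real.exp_pos _).le) (pow_nonneg hMt0 _)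
  have happ' : ∀ n : ℕ, (0 : ℝ) ≤ 2 ^ n * 2 ^ 2 ^ n * ((n : ℕ) * K₀ ^ n * ε₃₁) := fun n =>
    mul_nonneg (mul_nonneg (pow_nonneg (by norm_num) _) (pow_nonneg (by norm_num) _))
      (mul_nonneg (mul_nonneg (Nat.cast_nonneg _) (pow_nonneg hK₀0 _)) hε₃₁0)
  have hδ₃₁0 : ∀ k, 0 ≤ δ₃₁ k := fun k => by
    show (0 : ℝ) ≤ M ^ k * (2 ^ (k * D) * 2 ^ 2 ^ (k * D) * ((k * D : ℕ) * K₀ ^ (k * D) * ε₃₁))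
    exact mul_nonneg (pow_nonneg hM0 _) (happ' _)
  -- (C.8) on `I`: the conditioned mean is `≤ K₀` at every tessera of every class
  have hu : ∀ c, ∀ p ∈ Finset.Icc 1 s, ∀ Δ ∈ T c p, ∀ i,
      |condMean (freeCov d α β) Γ ξ (Δ i : B1Eq324BenfattoLemma.Site d)| ≤ K₀ := fun c p _ Δ _ i =>
    (Literature.MathematicalPhysics.QuantumFieldTheory.Balaban1983to89.B1Eq324BenfattoSect5SlotMoments.abs_condMean_le_of_mem
      hα hβ hγb Γ I ξ hξ (hJI (Δ i).2)).trans hK₀u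
  -- the (5.29)₂ input, per colouring using `Ψ″₁` and `Ψ₂`
  have h29 : ∀ k < t, ∀ f : Fin (k + 1) → Fin 3, (∃ j, f j = 1) → (∃ j, f j = 2) →
      |ursellOf (fun P : Finset (Fin (k + 1)) => ∫ z, ∏ j ∈ P,
          (∑ p ∈ Finset.Icc 1 s, ∑ Δ ∈ T (f j) p, ∑ n ∈ admissible p D, term κ a z p Δ n) ∂condField d α β Γ ξ) univ|
        ≤ δ₂₉ (k + 1) := by
    intro k _ f h1 h2
    obtain ⟨j₁, hj₁⟩ := h1
    obtain ⟨j₂, hj₂⟩ := h2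
    have h := Literature.MathematicalPhysics.QuantumFieldTheory.Balaban1983to89.B1Eq324BenfattoSect5TupleClusters.abs_ursellOf_tupleSums_condField_le_exp_of_separated
      (σ := Fin (k + 1)) (s := s) (D := D) (ϰ := κ) (a := a) hα hβ hd Γ ξ (fun j => T (f j)) hK₀1 hK₀C
      (fun j p hp Δ hΔ i => hu (f j) p hp Δ hΔ i) hδ0 hδle j₁ j₂
      (shrink L m (2 * w + v) : Set (B1Eq324BenfattoLemma.Site d))
      (↑(frame1 L w m ∪ frame2 L w m) : Set (B1Eq324BenfattoLemma.Site d)) (ρ₀ := (v : ℝ) + 1)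
      (fun p hp Δ hΔ => by
        rw [hj₁, hT1] at hΔ
        obtain ⟨i, hi⟩ := exists_mem_core_sdiff_frame4 hΔ
        exact ⟨i, Finset.mem_coe.2 hi⟩)
      (fun p hp Δ hΔ => by
        rw [hj₂, hT2] at hΔ
        have hp1 : 1 ≤ p := (Finset.mem_Icc.1 hp).1
        refine ⟨⟨0, hp1⟩, Finset.mem_coe.2 ?_⟩
        rcases Finset.mem_union.1 hΔ with h | h
        · exact (mem_crossT.1 h).1 _
        · exact Finset.mem_union_right _ ((mem_tuplesIn.1 h) _))
      (fun x hx y hy => by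
        rw [Finset.mem_coe, ← core_sdiff_frame4] at hx
        exact le_l1_core_sdiff_frame4_of_not_mem_core hx (not_mem_core_of_mem_frame1_union_frame2 (Finset.mem_coe.1 hy)))
    rw [Fintype.card_fin] at h
    refine h.trans ?_
    show _ ≤ 2 ^ ((k + 1) * D) * 2 ^ 2 ^ ((k + 1) * D) * K₀ ^ ((k + 1) * D) * Real.exp (-(δ / 2 * ((v : ℝ) + 1))) *
      Mt ^ (k + 1)
    refine mul_le_mul_of_nonneg_left ?_ (mul_nonneg (happ _) (Real.exp_pos _).le)
    calc _ ≤ ∏ _j : Fin (k + 1), Mt := Finset.prod_le_prod (fun j _ => hmasst0 (f j)) fun j _ => hMt (f j)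
      _ = Mt ^ (k + 1) := by rw [Finset.prod_const, Finset.card_univ, Fintype.card_fin]
  -- the (5.31) input, per colouring using `Ψ″₁` and avoiding `Ψ₂`
  have h31 : ∀ k < t, ∀ f : Fin (k + 1) → Fin 3, (∃ j, f j = 1) → (∀ j, f j ≠ 2) →
      |ursellOf (fun P : Finset (Fin (k + 1)) => ∫ z, ∏ j ∈ P,
            (∑ p ∈ Finset.Icc 1 s, ∑ Δ ∈ T (f j) p, ∑ n ∈ admissible p D, term κ a z p Δ n) ∂condField d α β Γ ξ) univ -
        ursellOf (fun P : Finset (Fin (k + 1)) => ∫ z, ∏ j ∈ P,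
            (∑ p ∈ Finset.Icc 1 s, ∑ Δ ∈ T (f j) p, ∑ n ∈ admissible p D, term κ a z p Δ n) ∂P0 d α β) univ|
        ≤ δ₃₁ (k + 1) := by
    intro k _ f _ h2
    have hf01 : ∀ j, f j = 0 ∨ f j = 1 := fun j => by
      have h := h2 j
      generalize f j = c at h ⊢
      fin_cases c
      · exact Or.inl rfl
      · exact Or.inr rfl
      · exact absurd rfl h
    -- tesserae of the `Ψ′₁`/`Ψ″₁` classes are at depth `w − v`
    have hdeep : ∀ j, ∀ p ∈ Finset.Icc 1 s, ∀ Δ ∈ T (f j) p, ∀ i,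
        (Δ i : B1Eq324BenfattoLemma.Site d) ∈ shrink L m (w + (w - v)) := fun j p _ Δ hΔ i =>
      mem_shrink_of_mem_class01 hv T hT0 hT1 (hf01 j) hΔ i
    have hCle : ∀ x y : B1Eq324BenfattoLemma.Site d, |condCov (freeCov d α β) Γ x y| ≤ K₀ := fun x y => by
      have h := condCov_freeCov_nonneg_le hα hβ Γ x y
      rw [abs_of_nonneg h.1]
      exact h.2.trans ((freeCov_le_diag hα hβ x y).trans hK₀C)
    have hGle : ∀ x y : B1Eq324BenfattoLemma.Site d, |freeCov d α β x y| ≤ K₀ := fun x y => by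
      rw [abs_of_nonneg (freeCov_nonneg hα hβ x y)]
      exact (freeCov_le_diag hα hβ x y).trans hK₀C
    have hsumξ : ∑ c ∈ frame1 L w m, |ξ c| ≤ γ * b * ∑ c ∈ frame1 L w m, (1 + distToRegion I c) := by
      rw [Finset.mul_sum]
      exact Finset.sum_le_sum fun c hc => hξ c (hΓ hc)
    have h := Literature.MathematicalPhysics.QuantumFieldTheory.Balaban1983to89.B1Eq324BenfattoSect5TupleClusters.abs_ursellOf_tupleSums_condField_sub_P0_le
      (σ := Fin (k + 1)) (s := s) (D := D) (ϰ := κ) (a := a) hα hβ Γ ξ (fun j => T (f j)) hK₀1 hε₃₁0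
      (fun j p hp Δ hΔ i => hu (f j) p hp Δ hΔ i) (fun j j' p _ p' _ Δ _ Δ' _ i i' => hCle _ _)
      (fun j j' p _ p' _ Δ _ Δ' _ i i' => hGle _ _)
      (fun j p hp Δ hΔ i => by
        refine (abs_condMean_le_of_mem_shrink hα hβ hw hΓ hΓd ξ (hdeep j p hp Δ hΔ i)).trans ?_
        exact le_max_of_le_left (mul_le_mul_of_nonneg_left hsumξ
          (mul_nonneg hβ.le (mul_nonneg (by positivity) (mul_nonneg hC00 hθpow)))))
      (fun j j' p hp p' _ Δ hΔ Δ' _ i i' => by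
        rw [abs_sub_comm]
        exact (abs_freeCov_sub_condCov_le_of_mem_shrink hα hβ hΓd (hdeep j p hp Δ hΔ i) _).trans (le_max_right _ _))
    rw [Fintype.card_fin] at h
    refine h.trans ?_
    show _ ≤ M ^ (k + 1) * (2 ^ ((k + 1) * D) * 2 ^ 2 ^ ((k + 1) * D) * (((k + 1) * D : ℕ) * K₀ ^ ((k + 1) * D) * ε₃₁))
    refine mul_le_mul_of_nonneg_right ?_ (happ' _)
    calc _ ≤ ∏ _j : Fin (k + 1), M := Finset.prod_le_prod (fun j _ => hmass0 (f j)) fun j _ => hM (f j)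
      _ = M ^ (k + 1) := by rw [Finset.prod_const, Finset.card_univ, Fintype.card_fin]
  exact perBox_condField hα hβ hvar hκ hJ hJI hA0 hA hv hb hγ0 hγ1 hγ hΓ hξ hsmall T hT0 hT1 hT2 hM hδ₂₉0 hδ₃₁0 h29 h31

end Plug

end Literature.MathematicalPhysics.QuantumFieldTheory.Balaban1983to89.B1Eq324BenfattoSect5PerBoxAppD
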